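import Literature.MathematicalPhysics.QuantumManyBody.PeriodicBoseGasFracEnergy
import Literature.MathematicalPhysics.QuantumManyBody.PeriodicBoseGasPQ
import Literature.MathematicalPhysics.QuantumManyBody.CondensateOccupationStability
import Summits.AtomisticToContinuum.BoseEinsteinCondensation.Theorems.BECConjugateDominationNearMinimiserStabilityHelpers
import HarnessLib

/-!
# Route `BECLatticeDepthHomotopy`, support item `ModeIdentification` (stmt-AtomisticToContinuum-12408):
# the mode-free condensate number `λ_max(γ_Ψ) = maxOccupation` is `2N`-Lipschitz on the unit sphere
# of `L²(cell)`

Helper file (supports, does not close, stmt-AtomisticToContinuum-12408). The item compares, at fixed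
`(N, L)`, the mode-free ground-state condensate number
`Λ(0) = sup_δ inf {λ_max(γ_Ψ) : 𝓔^per[Ψ] ≤ E₀ + δ}` with the constant-mode one
`periodicCondensateNumber = sup_δ inf {⟨Ψ, n₀ Ψ⟩ : 𝓔^per[Ψ] ≤ E₀ + δ}`. Both functionals have to be
followed along near-minimisers converging (up to a phase) to the ground state, which needs their
`L²(cell)`-continuity. For `n₀ = condensateOccupation` this is
`condensateOccupation_le_of_sub_le` (route `BECConjugateDomination`); this file proves the twin for
`λ_max(γ_Ψ) = maxOccupation N (1_{cell^N} Ψ)` (`Literature.MathematicalPhysics.QuantumManyBody.BoseGas.maxOccupation`,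
the supremum over normalised measurable one-body modes `φ` on `ℝ³` of the occupations
`⟨φ, γ_Ψ φ⟩ = occupation N φ (1_{cell^N} Ψ)`):

* `occupation_indicator_succ` — the occupation of a mode `φ` in the cell-restricted state through
  slices: `⟨φ, γ_Ψ φ⟩ = (n+1) ∫_{cell^n} |∫_cell conj(φ(x)) Ψ(x, Y) dx|² dY`;
* `nnnorm_setIntegral_conj_mul_sq_le`, `lintegral_slice_sq_le` — Cauchy–Schwarz on the cell:
  `|∫_cell conj(φ) k|² ≤ ∫_cell |k|²` for `∫_{ℝ³}|φ|² = 1`, hence the slice functional is dominated by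
  the cell norm, uniformly in the mode;
* `occupation_indicator_le_of_sub_le` — for continuous `f, g` with `∫_cell|g|² ≤ 1`,
  `∫_cell|f - g|² ≤ η²`: `⟨φ, γ_f φ⟩ ≤ ⟨φ, γ_g φ⟩ + (n+1)(2η + η²)` for EVERY normalised mode `φ`
  (Peter–Paul, as for `n₀`);
* `maxOccupation_indicator_le_of_sub_le` — the same for the supremum `λ_max`;
* `maxOccupation_const_mul` — phase covariance `λ_max(γ_{cΨ}) = |c|² λ_max(γ_Ψ)`.

References: E. H. Lieb, R. Seiringer, J. P. Solovej, J. Yngvason, *The Mathematics of the Bose Gas and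
its Condensation* (2005), §1.2 (1.17)–(1.19) [LSSY2005]; O. Penrose, L. Onsager, Phys. Rev. 104 (1956)
576, §4 [PenroseOnsager1956].
-/

noncomputable section

namespace Summit.AtomisticToContinuum.BoseEinsteinCondensation.Theorems.ModeIdentification

open MeasureTheory Filter
open scoped ENNReal NNReal Topology ComplexConjugate
open Literature.MathematicalPhysics.QuantumManyBody.BoseGas
open Summit.AtomisticToContinuum.BoseEinsteinCondensation.Theorems (coe_nnnorm_add_sq_le)

variable {n : ℕ} {L : ℝ}

/-! ### The occupation of a mode in a cell-restricted state, through slices -/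

/-- A tagged configuration `(x, Y)` lies in `cell^{n+1}` iff `x ∈ cell` and `Y ∈ cell^n`. [folklore] -/
theorem vecCons_mem_cellN_iff (x : Space) (Y : Config n) :
    (Matrix.vecCons x Y : Config (n + 1)) ∈ cellN (n + 1) L ↔ x ∈ cell L ∧ Y ∈ cellN n L := by
  constructor
  · intro h
    exact ⟨by simpa using h 0, fun k => by simpa using h k.succ⟩
  · rintro ⟨hx, hY⟩ j
    refine Fin.cases ?_ (fun k => ?_) j
    · simpa using hx
    · simpa using hY k

/-- **The occupation of a one-body mode in a cell-restricted state, through slices**: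
`⟨φ, γ_Ψ φ⟩ = occupation (n+1) φ (1_{cell^{n+1}} Ψ) = (n+1) ∫_{cell^n} |∫_cell conj(φ(x)) Ψ(x,Y) dx|² dY`
(unfolding `occupation`; the indicator restricts the tagged particle to the cell and the others to
`cell^n`). [cite: LSSY2005, §1.2 (1.17)] -/
theorem occupation_indicator_succ (L : ℝ) (φ : Space → ℂ) (f : Config (n + 1) → ℂ) :
    occupation (n + 1) φ ((cellN (n + 1) L).indicator f) =
      (n + 1 : ℝ≥0∞) * ∫⁻ Y in cellN n L,
        (‖∫ x in cell L, conj (φ x) * f (Matrix.vecCons x Y)‖₊ : ℝ≥0∞) ^ 2 := by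
  unfold occupation
  push_cast
  congr 1
  have hpt : ∀ Y : Config n,
      (‖∫ x, conj (φ x) * (cellN (n + 1) L).indicator f (Matrix.vecCons x Y)‖₊ : ℝ≥0∞) ^ 2 =
        (cellN n L).indicator (fun Y =>
          (‖∫ x in cell L, conj (φ x) * f (Matrix.vecCons x Y)‖₊ : ℝ≥0∞) ^ 2) Y := by
    intro Y
    by_cases hY : Y ∈ cellN n L
    · rw [Set.indicator_of_mem hY]
      have hint : (fun x => conj (φ x) * (cellN (n + 1) L).indicator f (Matrix.vecCons x Y)) =
          (cell L).indicator (fun x => conj (φ x) * f (Matrix.vecCons x Y)) := by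
        funext x
        by_cases hx : x ∈ cell L
        · have hmem : (Matrix.vecCons x Y : Config (n + 1)) ∈ cellN (n + 1) L :=
            (vecCons_mem_cellN_iff x Y).2 ⟨hx, hY⟩
          simp [hx, hmem, Set.indicator_of_mem]
        · have hmem : (Matrix.vecCons x Y : Config (n + 1)) ∉ cellN (n + 1) L := fun h =>
            hx ((vecCons_mem_cellN_iff x Y).1 h).1
          simp [hx, hmem]
      rw [hint, integral_indicator (measurableSet_cell L)]
    · rw [Set.indicator_of_notMem hY]
      have hint : (fun x => conj (φ x) * (cellN (n + 1) L).indicator f (Matrix.vecCons x Y)) =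
          fun _ => 0 := by
        funext x
        have hmem : (Matrix.vecCons x Y : Config (n + 1)) ∉ cellN (n + 1) L := fun h =>
          hY ((vecCons_mem_cellN_iff x Y).1 h).2
        simp [hmem]
      rw [hint]
      simp
  simp only [hpt]
  rw [lintegral_indicator (measurableSet_cellN n L)]

/-! ### Cauchy–Schwarz on the cell: slices are dominated by the cell norm, uniformly in the mode -/

/-- **Cauchy–Schwarz against a normalised mode**: for `∫_{ℝ³} |φ|² = 1` and any `k` on the cell,
`|∫_cell conj(φ(x)) k(x) dx|² ≤ ∫_cell |k|²` (`|∫ conj(φ) k| ≤ ∫ |φ||k| ≤ ‖φ‖_{L²(cell)} ‖k‖_{L²(cell)}`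
and `‖φ‖_{L²(cell)} ≤ ‖φ‖_{L²(ℝ³)} = 1`; no integrability is needed). [folklore] -/
theorem nnnorm_setIntegral_conj_mul_sq_le {φ : Space → ℂ} (hφ : AEStronglyMeasurable φ volume)
    (hφ1 : ∫⁻ x, (‖φ x‖₊ : ℝ≥0∞) ^ 2 = 1) {k : Space → ℂ}
    (hk : AEStronglyMeasurable k (volume.restrict (cell L))) :
    (‖∫ x in cell L, conj (φ x) * k x‖₊ : ℝ≥0∞) ^ 2 ≤ ∫⁻ x in cell L, (‖k x‖₊ : ℝ≥0∞) ^ 2 := by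
  have hφ' : AEMeasurable (fun x => (‖φ x‖₊ : ℝ≥0∞)) (volume.restrict (cell L)) :=
    hφ.restrict.aemeasurable.nnnorm.coe_nnreal_ennreal
  have hk' : AEMeasurable (fun x => (‖k x‖₊ : ℝ≥0∞)) (volume.restrict (cell L)) :=
    hk.aemeasurable.nnnorm.coe_nnreal_ennreal
  have hH := ENNReal.lintegral_mul_le_Lp_mul_Lq (volume.restrict (cell L))
    Real.HolderConjugate.two_two hφ' hk'
  simp only [Pi.mul_apply, ENNReal.rpow_two] at hH
  have hφcell : ∫⁻ x in cell L, (‖φ x‖₊ : ℝ≥0∞) ^ 2 ≤ 1 :=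
    hφ1 ▸ setLIntegral_le_lintegral _ _
  calc (‖∫ x in cell L, conj (φ x) * k x‖₊ : ℝ≥0∞) ^ 2
      ≤ (∫⁻ x in cell L, (‖conj (φ x) * k x‖₊ : ℝ≥0∞)) ^ 2 := by
        gcongr; exact enorm_integral_le_lintegral_enorm _
    _ = (∫⁻ x in cell L, (‖φ x‖₊ : ℝ≥0∞) * (‖k x‖₊ : ℝ≥0∞)) ^ 2 := by
        congr 1
        refine lintegral_congr fun x => ?_
        rw [nnnorm_mul, ENNReal.coe_mul, RCLike.nnnorm_conj]
    _ ≤ ((∫⁻ x in cell L, (‖φ x‖₊ : ℝ≥0∞) ^ 2) ^ (1 / 2 : ℝ) *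
          (∫⁻ x in cell L, (‖k x‖₊ : ℝ≥0∞) ^ 2) ^ (1 / 2 : ℝ)) ^ 2 := by gcongr
    _ ≤ ((1 : ℝ≥0∞) ^ (1 / 2 : ℝ) * (∫⁻ x in cell L, (‖k x‖₊ : ℝ≥0∞) ^ 2) ^ (1 / 2 : ℝ)) ^ 2 := by
        gcongr
    _ = ∫⁻ x in cell L, (‖k x‖₊ : ℝ≥0∞) ^ 2 := by
        rw [ENNReal.one_rpow, one_mul, ← ENNReal.rpow_two, ← ENNReal.rpow_mul]
        norm_num

/-- The slice integrand `(Y, x) ↦ conj(φ(x)) k(x, Y)` of a measurable mode against a continuous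
`k` is a.e. strongly measurable for the product of the cell measures. [folklore] -/
theorem aestronglyMeasurable_conj_mul_vecCons (L : ℝ) {φ : Space → ℂ}
    (hφ : AEStronglyMeasurable φ volume) {k : Config (n + 1) → ℂ} (hk : Continuous k) :
    AEStronglyMeasurable
      (Function.uncurry fun (Y : Config n) (x : Space) => conj (φ x) * k (Matrix.vecCons x Y))
      ((volume.restrict (cellN n L)).prod (volume.restrict (cell L))) := by
  have h1 : AEStronglyMeasurable (fun z : Config n × Space => conj (φ z.2))
      ((volume.restrict (cellN n L)).prod (volume.restrict (cell L))) :=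
    (Complex.continuous_conj.comp_aestronglyMeasurable hφ.restrict).comp_snd
  have h2 : AEStronglyMeasurable (fun z : Config n × Space => k (Matrix.vecCons z.2 z.1))
      ((volume.restrict (cellN n L)).prod (volume.restrict (cell L))) :=
    (hk.comp (continuous_snd.matrixVecCons continuous_fst)).aestronglyMeasurable
  exact h1.mul h2

/-- The squared slice functional `Y ↦ |∫_cell conj(φ(x)) k(x, Y) dx|²` of a measurable mode
against a continuous `k` is a.e. measurable on `cell^n`. [folklore] -/
theorem aemeasurable_slice_sq (L : ℝ) {φ : Space → ℂ} (hφ : AEStronglyMeasurable φ volume)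
    {k : Config (n + 1) → ℂ} (hk : Continuous k) :
    AEMeasurable (fun Y : Config n =>
      (‖∫ x in cell L, conj (φ x) * k (Matrix.vecCons x Y)‖₊ : ℝ≥0∞) ^ 2)
      (volume.restrict (cellN n L)) :=
  (aestronglyMeasurable_conj_mul_vecCons L hφ hk).integral_prod_right'.aemeasurable
    |>.nnnorm.coe_nnreal_ennreal.pow_const _

/-- **Slices are dominated by the cell norm, uniformly in the mode**: for `∫_{ℝ³}|φ|² = 1` and
continuous `k`, `∫_{cell^n} |∫_cell conj(φ(x)) k(x,Y) dx|² dY ≤ ∫_{cell^{n+1}} |k|²`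
(Cauchy–Schwarz on each slice and Tonelli). [folklore] -/
theorem lintegral_slice_sq_le (L : ℝ) {φ : Space → ℂ} (hφ : AEStronglyMeasurable φ volume)
    (hφ1 : ∫⁻ x, (‖φ x‖₊ : ℝ≥0∞) ^ 2 = 1) {k : Config (n + 1) → ℂ} (hk : Continuous k) :
    ∫⁻ Y in cellN n L, (‖∫ x in cell L, conj (φ x) * k (Matrix.vecCons x Y)‖₊ : ℝ≥0∞) ^ 2 ≤
      ∫⁻ X in cellN (n + 1) L, (‖k X‖₊ : ℝ≥0∞) ^ 2 := by
  rw [lintegral_cellN_succ L (F := fun X => (‖k X‖₊ : ℝ≥0∞) ^ 2)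
      (hk.measurable.nnnorm.coe_nnreal_ennreal.pow_const _)]
  refine lintegral_mono fun Y => ?_
  have hcont : Continuous fun x : Space => k (Matrix.vecCons x Y) :=
    hk.comp (continuous_id.matrixVecCons continuous_const)
  exact nnnorm_setIntegral_conj_mul_sq_le hφ hφ1 hcont.aestronglyMeasurable

/-- In particular the occupation of a normalised mode in a cell-restricted continuous state is at
most `(n+1) ∫_cell |Ψ|²` (`≤ N` for a normalised state: `γ_Ψ ≤ N`). [cite: LSSY2005, §1.2 (1.18)] -/
theorem occupation_indicator_le_mul_lintegral (L : ℝ) {φ : Space → ℂ}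
    (hφ : AEStronglyMeasurable φ volume) (hφ1 : ∫⁻ x, (‖φ x‖₊ : ℝ≥0∞) ^ 2 = 1)
    {k : Config (n + 1) → ℂ} (hk : Continuous k) :
    occupation (n + 1) φ ((cellN (n + 1) L).indicator k) ≤
      (n + 1 : ℝ≥0∞) * ∫⁻ X in cellN (n + 1) L, (‖k X‖₊ : ℝ≥0∞) ^ 2 := by
  rw [occupation_indicator_succ]
  gcongr
  exact lintegral_slice_sq_le L hφ hφ1 hk

/-- `λ_max(γ_Ψ) ≤ (n+1) ∫_cell |Ψ|²` for a continuous state restricted to the cell (the supremum of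
`occupation_indicator_le_mul_lintegral`). [cite: LSSY2005, §1.2 (1.18)] -/
theorem maxOccupation_indicator_le_mul_lintegral (L : ℝ) {k : Config (n + 1) → ℂ}
    (hk : Continuous k) :
    maxOccupation (n + 1) ((cellN (n + 1) L).indicator k) ≤
      (n + 1 : ℝ≥0∞) * ∫⁻ X in cellN (n + 1) L, (‖k X‖₊ : ℝ≥0∞) ^ 2 :=
  iSup₂_le fun _ hφ => occupation_indicator_le_mul_lintegral L hφ.1 hφ.2 hk

/-! ### The Lipschitz estimate -/

/-- The slice integrand of a normalised mode against a continuous state is integrable on the cell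
(`conj(φ) ∈ L²(cell) ⊂ L¹(cell)` and the continuous slice is bounded on the cell). [folklore] -/
theorem integrable_conj_mul_vecCons (L : ℝ) {φ : Space → ℂ} (hφ : AEStronglyMeasurable φ volume)
    (hφ1 : ∫⁻ x, (‖φ x‖₊ : ℝ≥0∞) ^ 2 = 1) {k : Config (n + 1) → ℂ} (hk : Continuous k)
    (Y : Config n) :
    Integrable (fun x => conj (φ x) * k (Matrix.vecCons x Y)) (volume.restrict (cell L)) := by
  haveI : IsFiniteMeasure (volume.restrict (cell L)) :=
    isFiniteMeasure_restrict.2 (by rw [volume_cell]; exact ENNReal.pow_ne_top ENNReal.ofReal_ne_top)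
  have hkc : Continuous fun x : Space => k (Matrix.vecCons x Y) :=
    hk.comp (continuous_id.matrixVecCons continuous_const)
  obtain ⟨C, hC⟩ := (isCompact_closedBox L).exists_bound_of_continuousOn hkc.continuousOn
  have hφ2 : MemLp (fun x => conj (φ x)) 2 (volume.restrict (cell L)) := by
    refine memLp_two_of_lintegral_ne_top
      (Complex.continuous_conj.comp_aestronglyMeasurable hφ.restrict) ?_
    simp only [RCLike.nnnorm_conj]
    exact ne_top_of_le_ne_top ENNReal.one_ne_top (hφ1 ▸ setLIntegral_le_lintegral _ _)
  have hφint : Integrable (fun x => conj (φ x)) (volume.restrict (cell L)) :=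
    hφ2.integrable one_le_two
  refine hφint.mul_bdd hkc.aestronglyMeasurable (c := C) ?_
  filter_upwards [ae_restrict_mem (measurableSet_cell L)] with x hx
  exact hC x (cell_subset_closedBox L hx)

/-- **The occupation of every normalised mode is `2N`-Lipschitz on the unit sphere of `L²(cell)`,
uniformly in the mode**: for continuous `f, g` on `(ℝ³)^{n+1}` with `∫_cell |g|² ≤ 1` and
`∫_cell |f - g|² ≤ η²` (`η > 0`) and every mode `φ` with `∫_{ℝ³}|φ|² = 1`,
`⟨φ, γ_f φ⟩ ≤ ⟨φ, γ_g φ⟩ + (n+1)(2η + η²)`. Proof: through slices (`occupation_indicator_succ`),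
`|∫conj(φ)f|² ≤ (1+η)|∫conj(φ)g|² + (1+η⁻¹)|∫conj(φ)(f-g)|²` pointwise in `Y` (Peter–Paul), and the
slice functional is dominated by the cell norm (`lintegral_slice_sq_le`).
[cite: LSSY2005, §1.2 (1.17)–(1.18)] -/
theorem occupation_indicator_le_of_sub_le (L : ℝ) {φ : Space → ℂ}
    (hφ : AEStronglyMeasurable φ volume) (hφ1 : ∫⁻ x, (‖φ x‖₊ : ℝ≥0∞) ^ 2 = 1)
    {f g : Config (n + 1) → ℂ} (hf : Continuous f) (hg : Continuous g)
    (hg1 : ∫⁻ X in cellN (n + 1) L, (‖g X‖₊ : ℝ≥0∞) ^ 2 ≤ 1) {η : ℝ} (hη : 0 < η)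
    (hfg : ∫⁻ X in cellN (n + 1) L, (‖f X - g X‖₊ : ℝ≥0∞) ^ 2 ≤ ENNReal.ofReal (η ^ 2)) :
    occupation (n + 1) φ ((cellN (n + 1) L).indicator f) ≤
      occupation (n + 1) φ ((cellN (n + 1) L).indicator g) +
        ENNReal.ofReal (((n + 1 : ℕ) : ℝ) * (2 * η + η ^ 2)) := by
  rw [occupation_indicator_succ L φ f, occupation_indicator_succ L φ g]
  set h : Config (n + 1) → ℂ := fun X => f X - g X with hh
  have hhc : Continuous h := hf.sub hg
  set Ig : Config n → ℝ≥0∞ := fun Y =>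
    (‖∫ x in cell L, conj (φ x) * g (Matrix.vecCons x Y)‖₊ : ℝ≥0∞) ^ 2 with hIgdef
  set Ih : Config n → ℝ≥0∞ := fun Y =>
    (‖∫ x in cell L, conj (φ x) * h (Matrix.vecCons x Y)‖₊ : ℝ≥0∞) ^ 2 with hIhdef
  -- pointwise splitting and Peter–Paul
  have hpt : ∀ Y : Config n,
      (‖∫ x in cell L, conj (φ x) * f (Matrix.vecCons x Y)‖₊ : ℝ≥0∞) ^ 2 ≤
        ENNReal.ofReal (1 + η) * Ig Y + ENNReal.ofReal (1 + η⁻¹) * Ih Y := by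
    intro Y
    have hsplit : ∫ x in cell L, conj (φ x) * f (Matrix.vecCons x Y) =
        (∫ x in cell L, conj (φ x) * g (Matrix.vecCons x Y)) +
          ∫ x in cell L, conj (φ x) * h (Matrix.vecCons x Y) := by
      rw [← integral_add (integrable_conj_mul_vecCons L hφ hφ1 hg Y)
        (integrable_conj_mul_vecCons L hφ hφ1 hhc Y)]
      refine integral_congr_ae (Eventually.of_forall fun x => ?_)
      simp only [hh]
      ring
    rw [hsplit]
    exact coe_nnnorm_add_sq_le _ _ hη
  -- integrate over `Y`
  have hIg : AEMeasurable Ig (volume.restrict (cellN n L)) := aemeasurable_slice_sq L hφ hg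
  have hIh : AEMeasurable Ih (volume.restrict (cellN n L)) := aemeasurable_slice_sq L hφ hhc
  have hint : (∫⁻ Y in cellN n L,
      (‖∫ x in cell L, conj (φ x) * f (Matrix.vecCons x Y)‖₊ : ℝ≥0∞) ^ 2) ≤
      ENNReal.ofReal (1 + η) * (∫⁻ Y in cellN n L, Ig Y) +
        ENNReal.ofReal (1 + η⁻¹) * (∫⁻ Y in cellN n L, Ih Y) := by
    calc ∫⁻ Y in cellN n L, (‖∫ x in cell L, conj (φ x) * f (Matrix.vecCons x Y)‖₊ : ℝ≥0∞) ^ 2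
        ≤ ∫⁻ Y in cellN n L, (ENNReal.ofReal (1 + η) * Ig Y + ENNReal.ofReal (1 + η⁻¹) * Ih Y) :=
          lintegral_mono fun Y => hpt Y
      _ = _ := by
          rw [lintegral_add_left' (hIg.const_mul _), lintegral_const_mul'' _ hIg,
            lintegral_const_mul'' _ hIh]
  -- the two slice functionals
  have hAg : (∫⁻ Y in cellN n L, Ig Y) ≤ 1 := (lintegral_slice_sq_le L hφ hφ1 hg).trans hg1
  have hAh : (∫⁻ Y in cellN n L, Ih Y) ≤ ENNReal.ofReal (η ^ 2) :=
    (lintegral_slice_sq_le L hφ hφ1 hhc).trans hfg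
  -- bookkeeping
  have hη1 : ENNReal.ofReal (1 + η) = 1 + ENNReal.ofReal η := by
    rw [ENNReal.ofReal_add zero_le_one hη.le, ENNReal.ofReal_one]
  have herr : ENNReal.ofReal η * 1 + ENNReal.ofReal (1 + η⁻¹) * ENNReal.ofReal (η ^ 2) =
      ENNReal.ofReal (2 * η + η ^ 2) := by
    rw [mul_one, ← ENNReal.ofReal_mul (by positivity), ← ENNReal.ofReal_add hη.le (by positivity)]
    congr 1
    field_simp
    ring
  calc ((n : ℝ≥0∞) + 1) *
        ∫⁻ Y in cellN n L, (‖∫ x in cell L, conj (φ x) * f (Matrix.vecCons x Y)‖₊ : ℝ≥0∞) ^ 2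
      ≤ ((n : ℝ≥0∞) + 1) * (ENNReal.ofReal (1 + η) * (∫⁻ Y in cellN n L, Ig Y) +
          ENNReal.ofReal (1 + η⁻¹) * (∫⁻ Y in cellN n L, Ih Y)) := by gcongr
    _ = ((n : ℝ≥0∞) + 1) * (∫⁻ Y in cellN n L, Ig Y) +
          ((n : ℝ≥0∞) + 1) * (ENNReal.ofReal η * (∫⁻ Y in cellN n L, Ig Y) +
            ENNReal.ofReal (1 + η⁻¹) * (∫⁻ Y in cellN n L, Ih Y)) := by
        rw [hη1]; ring
    _ ≤ ((n : ℝ≥0∞) + 1) * (∫⁻ Y in cellN n L, Ig Y) +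
          ((n : ℝ≥0∞) + 1) * (ENNReal.ofReal η * 1 +
            ENNReal.ofReal (1 + η⁻¹) * ENNReal.ofReal (η ^ 2)) := by gcongr
    _ = ((n : ℝ≥0∞) + 1) * (∫⁻ Y in cellN n L, Ig Y) +
          ENNReal.ofReal (((n + 1 : ℕ) : ℝ) * (2 * η + η ^ 2)) := by
        rw [herr, ENNReal.ofReal_mul (by positivity), ENNReal.ofReal_natCast]
        push_cast
        ring

/-- **`λ_max(γ_Ψ)` is `2N`-Lipschitz on the unit sphere of `L²(cell)`**: for continuous `f, g` on
`(ℝ³)^{n+1}` with `∫_cell |g|² ≤ 1` and `∫_cell |f - g|² ≤ η²` (`η > 0`),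
`λ_max(γ_f) ≤ λ_max(γ_g) + (n+1)(2η + η²)`, where `λ_max(γ_Ψ) = maxOccupation (n+1) (1_{cell^{n+1}} Ψ)`
(the supremum over modes of `occupation_indicator_le_of_sub_le`). [cite: LSSY2005, §1.2 (1.17)–(1.19)] -/
theorem maxOccupation_indicator_le_of_sub_le (L : ℝ) {f g : Config (n + 1) → ℂ}
    (hf : Continuous f) (hg : Continuous g)
    (hg1 : ∫⁻ X in cellN (n + 1) L, (‖g X‖₊ : ℝ≥0∞) ^ 2 ≤ 1) {η : ℝ} (hη : 0 < η)
    (hfg : ∫⁻ X in cellN (n + 1) L, (‖f X - g X‖₊ : ℝ≥0∞) ^ 2 ≤ ENNReal.ofReal (η ^ 2)) :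
    maxOccupation (n + 1) ((cellN (n + 1) L).indicator f) ≤
      maxOccupation (n + 1) ((cellN (n + 1) L).indicator g) +
        ENNReal.ofReal (((n + 1 : ℕ) : ℝ) * (2 * η + η ^ 2)) := by
  refine iSup₂_le fun φ hφ => ?_
  calc occupation (n + 1) φ ((cellN (n + 1) L).indicator f)
      ≤ occupation (n + 1) φ ((cellN (n + 1) L).indicator g) +
          ENNReal.ofReal (((n + 1 : ℕ) : ℝ) * (2 * η + η ^ 2)) :=
        occupation_indicator_le_of_sub_le L hφ.1 hφ.2 hf hg hg1 hη hfg
    _ ≤ maxOccupation (n + 1) ((cellN (n + 1) L).indicator g) +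
          ENNReal.ofReal (((n + 1 : ℕ) : ℝ) * (2 * η + η ^ 2)) := by
        gcongr
        exact occupation_le_maxOccupation _ hφ.1 hφ.2

/-! ### Phase covariance -/

/-- **Phase covariance of `λ_max`**: `λ_max(γ_{cΨ}) = |c|² λ_max(γ_Ψ)` (every occupation scales by
`|c|²`, `occupation_const_mul`). [folklore] -/
theorem maxOccupation_const_mul (N : ℕ) (c : ℂ) (Ψ : Config N → ℂ) :
    maxOccupation N (fun X => c * Ψ X) = (‖c‖₊ : ℝ≥0∞) ^ 2 * maxOccupation N Ψ := by
  unfold maxOccupation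
  simp_rw [occupation_const_mul, ENNReal.mul_iSup]

/-- Phase covariance read through the cell indicator:
`λ_max(γ_{1_cell · cΨ}) = |c|² λ_max(γ_{1_cell Ψ})`. [folklore] -/
theorem maxOccupation_indicator_const_mul (N : ℕ) (L : ℝ) (c : ℂ) (Ψ : Config N → ℂ) :
    maxOccupation N ((cellN N L).indicator fun X => c * Ψ X) =
      (‖c‖₊ : ℝ≥0∞) ^ 2 * maxOccupation N ((cellN N L).indicator Ψ) := by
  have h : ((cellN N L).indicator fun X => c * Ψ X) = fun X => c * (cellN N L).indicator Ψ X := by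
    funext X
    exact Set.indicator_const_mul _ _ _ _
  rw [h, maxOccupation_const_mul]

end Summit.AtomisticToContinuum.BoseEinsteinCondensation.Theorems.ModeIdentification

end
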